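import Literature.MathematicalPhysics.QuantumFieldTheory.Balaban1983to89.B13OpsYPencilRProj

/-!
# `Balaban1983to89.B13OpsYPencilGreen` — T. Bałaban, *Propagators for lattice gauge theories in a background field*, Commun. Math. Phys. **99** (1985)
389–434 [Balaban1985BackgroundPropagators], (3.3) p. 390 and (3.8) p. 392 (`D_U`, `D*_U`), (3.26)–(3.27) p. 395 («Δ_a(U) = Δ(U) + D_U R(U) D*_U + Q*(U)aQ(U)»,
«G(U) = Δ_a(U)⁻¹»), Thm 3.3 p. 399, Thm 3.4 p. 400, Sect. B (3.84)–(3.86) p. 407 («G(U′U) = G(U)(I − V(A)G(U))⁻¹»), Thm 3.10 (3.107)–(3.108) p. 416;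
*Renormalization group approach to lattice gauge field theories. II*, Commun. Math. Phys. **116** (1988) 1–22 [Balaban1988RG2Cluster] (2.5)–(2.7) pp. 12–13,
p. 15: THE G-STATION — THE LAST INVERSE OF PRINT's CHAIN, NODE 00's PROPAGATOR `G(e^{iηA′}U₀) = Δ_a(e^{iηA′}U₀)⁻¹` (`Node00.GAY`) IN THE N10 ENTRY-LETTER
CURRENCY ALONG pv27's PENCIL, TRANSPORTER-GENERIC (any `parS`, `parB`, `Gp` — def-Y's v2 or v4 letters; dag-n10-c g15's located fork), from the R-station
(`B13OpsYPencilRProj`) and the lane's local part (`B13OpsYPencilDeltaALocal`).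

`Δ_a = [Δ(U) + Q*(U)aQ(U)] + D_U R(U) D*_U` (`B13OpsYPencilDeltaALocal.deltaAY_apply_eq`): the bracket is LOCAL (the lane's p602717 gives its holomorphy
and bound along the pencil; its square `RawEntryLetters` datum on the bond sector is DISPLAYED here as ONE hypothesis `hLoc`, the lane's ∕ a packaging
step's); the second summand is a u-dependent LOCAL RECTANGULAR sandwich of the site-sector square family `R(U)` (the R-station's output, displayed) by
NODE 00's `D_U` (bonds × sites) and `D*_U` (sites × bonds) — (D′) `rawEntryLetters_sandwich_family` with the lane's 69 facts for `gradY ∕ divY`.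
* §1 `D_U ∕ D*_U` ALONG THE PENCIL AS RECTANGULAR LOCAL FAMILIES (69 + 68 `trLiftY_single`): `toMatrix_gradY_eq ∕ toMatrix_divY_eq`,
  `differentiableOn_toMatrix_gradY∕divY_prodCfg`, `tdist_le_of_toMatrix_gradY∕divY_ne_zero` (readings `ℓF`, `ℓS`, ONE numeral `r′`: `gradK(b,z) ≠ 0 ⇒
  d₁(ℓF b, ℓS z) ≤ r′`, `divK(z,b) ≠ 0 ⇒ d₁(ℓS z, ℓF b) ≤ r′`), `norm_toMatrix_gradY∕divY_prodCfg_le` (`≤ |gradK(b,z)|·cb·(Kη·cl·Kη)`), `rowSum_toMatrix_gradY_prodCfg_le`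
  (numeral `CgR ≥ Σ_z|gradK(b,z)|` — print: `2`), `colSum_toMatrix_divY_prodCfg_le` (numeral `CdC ≥ Σ_z|divK(z,b)|` — print: `2`).
* §2 `toMatrix_deltaAY_eq` (`toMatrix_F(Δ_a(U)) = toMatrix_F(Δ(U) + Q*aQ(U)) + toMatrix(D_U)·toMatrix_S(R(U))·toMatrix(D*_U)`).
* §3 ★★ `rawEntryLetters_toMatrix_DRD_prodCfg` (`D_U R D*_U` along the pencil on the bond sector from R's pencil letters — no rate loss), ★★
  `rawEntryLetters_toMatrix_deltaAY_prodCfg` (`Δ_a` along the pencil = `hLoc` + §3, 34 `rawEntryLetters_add`).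
* §4 ★★★ `rawEntryLetters_toMatrix_GAY_prodCfg_of_pencil` — THE G-JUNCTION: p601656 §5 (`…ringInverse_located_of_kernelBound`, `prodCfg_zero`, `deltaAY_mul_GAY`) ⟹
  `RawEntryLetters (A′ ↦ toMatrix (G(e^{iηA′}U₀))) (ℓF ∘ fst) R₁⋆ ρ′ (2·cb·cl·B_Γ)` at the located thin radius for every `0 ≤ ρ′ < ρ`, DISPLAYING: the local
  part's pencil letters (`hLoc`), R's pencil letters (the R-station's output, hence G′'s and X⁻¹'s), the `D ∕ D*` numerals, and N06's content at the ONE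
  real background `U₀` — `IsUnit (Δ_a(U₀))` and the pointwise (3.108)-type bound for `G(U₀)` (Thm 3.3 ∕ 3.10, GAPS G-B9-05∕06a∕07) —, a fibre bound of `ℓF`,
  `0 < R`.  With `B13OpsYPencilGreenPrime` (G′), `B13OpsYPencilXQuad` (X⁻¹), `B13OpsYPencilRProj` (R) this closes the READING of print's Sect. B chain
  `G′ → (Q′G′²Q′*)⁻¹ → R → Δ_a → G` at NODE 00's operators of record in the N10 currency: every inverse's letters along the complex pencil display exactly
  N06's theorems at ONE real background, the lane's local pencil letters, NODE 00's numerals, and nothing else.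
HONEST FRAMING: readers + located numerals over 69 ∕ (D′) ∕ 34 ∕ p595959–p605318; NODE 00's `gradY ∕ divY ∕ gradK ∕ divK ∕ gradT ∕ hessY ∕ QY ∕ QsY ∕ aY ∕ RY ∕
deltaAY ∕ GAY`, pv27's `prodCfg` CONSUMED BY NAME, nothing of `Node00/OpsY*` modified; the displayed inputs carry N06's Thms 3.1–3.3 ∕ 3.10 at
`U₀` and the lane's letters; nothing of Bałaban's asserted; N06 ∕ N10 NOT discharged; K1⁷ NOT closed; counts unmoved (typed 28∕28 · discharged 5∕27); THEOREMS
ONLY, 0 `sorry`, standard axioms; one finite 𝕋⁴ programme at fixed ε — R4 closes the conditional finite-𝕋⁴ rung `BalabanLadder.UV` only; the YM mass gap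
(Clay) is NOT proved by any of this; nothing continuum ∕ ℝ⁴ ∕ OS.

References: T. Bałaban, CMP 99 (1985) 389–434 [Balaban1985BackgroundPropagators] (3.3) p.390, (3.8) p.392, (3.25)–(3.27) pp.394–395, Thm 3.3 p.399, Thm 3.4 and
(3.50) p.400, (3.84)–(3.86) p.407, Thm 3.10 (3.107)–(3.108) pp.415–416; CMP 116 (1988) 1–22 [Balaban1988RG2Cluster] (2.5)–(2.7) pp.12–13, p.15; CMP 96 (1984)
223–250 [Balaban1984PropagatorsII] (2.54) p.232, Lemma 2.1 (2.61) p.234.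
-/

noncomputable section

namespace Literature.MathematicalPhysics.QuantumFieldTheory.Balaban1983to89.B13OpsYPencilGreen

open Metric Set Finset Module
open scoped Matrix
open Literature.MathematicalPhysics.QuantumFieldTheory.Balaban1983to89
open Literature.MathematicalPhysics.QuantumFieldTheory.Balaban1983to89.B9Thm37GlueTorus (tdist1)
open Literature.MathematicalPhysics.QuantumFieldTheory.Balaban1983to89.B5TorusCover (UT)
open Literature.MathematicalPhysics.QuantumFieldTheory.Balaban1983to89.B13EntrywiseWalks (RawEntryLetters)
open Literature.MathematicalPhysics.QuantumFieldTheory.Balaban1983to89.B13EntryLetterAlgebra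
  (rawEntryLetters_mono rawEntryLetters_congr rawEntryLetters_add)
open Literature.MathematicalPhysics.QuantumFieldTheory.Balaban1983to89.B13EntryLetterAlgebraFamily (rawEntryLetters_sandwich_family)
open Literature.MathematicalPhysics.QuantumFieldTheory.Balaban1983to89.B13InverseOperatorCoordinates
  (rawEntryLetters_toMatrix_ringInverse_located_of_kernelBound)
open Literature.MathematicalPhysics.QuantumFieldTheory.Balaban1983to89.B13OpsYPencilXQuad (toMatrix_piProd_rect_apply)
open Literature.MathematicalPhysics.QuantumFieldTheory.Balaban1983to89.B13OpsYPencilLetters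
  (differentiableOn_coord_gradY_prodCfg norm_coord_gradY_prodCfg_le differentiableOn_coord_divY_prodCfg norm_coord_divY_prodCfg_le)
open Literature.MathematicalPhysics.QuantumFieldTheory.Balaban1983to89.B13TransportedLiftLetters (trLiftY_single)
open Literature.MathematicalPhysics.QuantumFieldTheory.Balaban1983to89.B9Eq39Adjoint (R R_def prodCfg)
open Literature.MathematicalPhysics.QuantumFieldTheory.Balaban1983to89.B9Eq369Product (prodCfg_zero)
open Literature.MathematicalPhysics.QuantumFieldTheory.Balaban1983to89.B6GlobalChartV1 (PV boxEquiv)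
open Literature.MathematicalPhysics.QuantumFieldTheory.Balaban1983to89.B6KLevelCensusIndexV1 (KIdx)
open Literature.MathematicalPhysics.QuantumFieldTheory.Balaban1983to89.Node00

variable {𝔸 : Type} [NormedRing 𝔸] [NormedAlgebra ℂ 𝔸] [CompleteSpace 𝔸]
variable {d ℓ : ℕ} {hd : 1 ≤ d + 1} {hL : Odd (ℓ + 1) ∧ 1 < ℓ + 1} {b₀ b₁ : ℝ}
variable (i : KIdx d ℓ hd hL b₀ b₁)
variable {κ : Type} [Fintype κ] [DecidableEq κ] (b : Basis κ ℂ 𝔸)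
variable (U₀ : CfgY 𝔸 i) (η : ℝ) {Rc K₀ : ℝ}
variable [DecidableEq (SiteY i)] [DecidableEq (FBondY i)]

/-! ## §1. `D_U`, `D*_U` along the pencil as rectangular local families -/

section Derivatives

omit [DecidableEq (FBondY i)] in
/-- `D_U` IDENTIFIED: `toMatrix_{S→F}(D_U)(b,k)(z,l) = gradK(b,z)·b.repr(R(gradT(U)(b,z)) b_l) k` — any `U` (68 `trLiftY_single` at `gradY U = (gradK)♯_{gradT U}`).
[cite: Balaban1985BackgroundPropagators, (3.3) p.390] -/
theorem toMatrix_gradY_eq (U : CfgY 𝔸 i) (bb : FBondY i) (k : κ) (z : SiteY i) (l : κ) :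
    LinearMap.toMatrix ((Pi.basis fun _ : SiteY i => b).reindex (Equiv.sigmaEquivProd (SiteY i) κ))
      ((Pi.basis fun _ : FBondY i => b).reindex (Equiv.sigmaEquivProd (FBondY i) κ)) (gradY i U) (bb, k) (z, l) =
      ((gradK i bb z : ℝ) : ℂ) * b.repr (R (gradT i U bb z) (b l)) k := by
  rw [toMatrix_piProd_rect_apply]
  show b.repr (trLiftY (gradK i) (gradT i U) (Pi.single z (b l)) bb) k = _
  rw [trLiftY_single, map_smul, Finsupp.smul_apply, smul_eq_mul]

omit [DecidableEq (SiteY i)] in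
/-- `D*_U` IDENTIFIED: `toMatrix_{F→S}(D*_U)(z,k)(b,l) = divK(z,b)·b.repr(R(gradT(U)(b,z)⁻¹) b_l) k` (`divY U = (divK)♯` along the inverted transporters).
[cite: Balaban1985BackgroundPropagators, (3.8) p.392] -/
theorem toMatrix_divY_eq (U : CfgY 𝔸 i) (z : SiteY i) (k : κ) (bb : FBondY i) (l : κ) :
    LinearMap.toMatrix ((Pi.basis fun _ : FBondY i => b).reindex (Equiv.sigmaEquivProd (FBondY i) κ))
      ((Pi.basis fun _ : SiteY i => b).reindex (Equiv.sigmaEquivProd (SiteY i) κ)) (divY i U) (z, k) (bb, l) =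
      ((divK i z bb : ℝ) : ℂ) * b.repr (R (gradT i U bb z)⁻¹ (b l)) k := by
  rw [toMatrix_piProd_rect_apply]
  show b.repr (trLiftY (divK i) (fun z bb => (gradT i U bb z)⁻¹) (Pi.single bb (b l)) z) k = _
  rw [trLiftY_single, map_smul, Finsupp.smul_apply, smul_eq_mul]

omit [DecidableEq (FBondY i)] in
/-- `D_U` along the pencil: every rectangular matrix entry is HOLOMORPHIC (69 `differentiableOn_coord_gradY_prodCfg` at `φ_k := (b.coord k).mkContinuous cb`).
[cite: Balaban1985BackgroundPropagators, (3.3) p.390, Thm 3.4 and (3.50) p.400] -/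
theorem differentiableOn_toMatrix_gradY_prodCfg {cb : ℝ} (hcb : ∀ (x : 𝔸) (k : κ), ‖b.repr x k‖ ≤ cb * ‖x‖) (p : FBondY i × κ) (q : SiteY i × κ) :
    DifferentiableOn ℂ (fun a : Fin (d + 1) → Site (PV d ℓ i.m i.K hd hL) 0 → 𝔸 =>
      LinearMap.toMatrix ((Pi.basis fun _ : SiteY i => b).reindex (Equiv.sigmaEquivProd (SiteY i) κ))
        ((Pi.basis fun _ : FBondY i => b).reindex (Equiv.sigmaEquivProd (FBondY i) κ)) (gradY i (prodCfg U₀ η a)) p q) (ball 0 Rc) := by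
  obtain ⟨bb, k⟩ := p
  obtain ⟨z, l⟩ := q
  have h := differentiableOn_coord_gradY_prodCfg i U₀ η (Rc := Rc)
    (fun k => (b.coord k).mkContinuous cb (fun x => by rw [Basis.coord_apply]; exact hcb x k)) b bb z k l
  refine h.congr fun a _ => ?_
  rw [toMatrix_gradY_eq, LinearMap.mkContinuous_apply, Basis.coord_apply]

omit [DecidableEq (SiteY i)] in
/-- `D*_U` along the pencil: every rectangular matrix entry is HOLOMORPHIC (69 `differentiableOn_coord_divY_prodCfg`).
[cite: Balaban1985BackgroundPropagators, (3.8) p.392, Thm 3.4 p.400] -/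
theorem differentiableOn_toMatrix_divY_prodCfg {cb : ℝ} (hcb : ∀ (x : 𝔸) (k : κ), ‖b.repr x k‖ ≤ cb * ‖x‖) (q : SiteY i × κ) (p : FBondY i × κ) :
    DifferentiableOn ℂ (fun a : Fin (d + 1) → Site (PV d ℓ i.m i.K hd hL) 0 → 𝔸 =>
      LinearMap.toMatrix ((Pi.basis fun _ : FBondY i => b).reindex (Equiv.sigmaEquivProd (FBondY i) κ))
        ((Pi.basis fun _ : SiteY i => b).reindex (Equiv.sigmaEquivProd (SiteY i) κ)) (divY i (prodCfg U₀ η a)) q p) (ball 0 Rc) := by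
  obtain ⟨z, k⟩ := q
  obtain ⟨bb, l⟩ := p
  have h := differentiableOn_coord_divY_prodCfg i U₀ η (Rc := Rc)
    (fun k => (b.coord k).mkContinuous cb (fun x => by rw [Basis.coord_apply]; exact hcb x k)) b z bb k l
  refine h.congr fun a _ => ?_
  rw [toMatrix_divY_eq, LinearMap.mkContinuous_apply, Basis.coord_apply]

variable {ν : ℕ} {Nf : Fin ν → ℕ} [∀ j, NeZero (Nf j)]

omit [DecidableEq (FBondY i)] in
/-- `D_U`: RANGE through the readings `ℓF : FBondY i → UT Nf`, `ℓS : SiteY i → UT Nf` (one numeral `r′`: `gradK(b,z) ≠ 0 ⇒ d₁(ℓF b, ℓS z) ≤ r′`; displayed).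
[cite: Balaban1985BackgroundPropagators, (3.3) p.390 (nearest neighbours), (3.108) p.416] -/
theorem tdist_le_of_toMatrix_gradY_ne_zero (ℓS : SiteY i → UT Nf) (ℓF : FBondY i → UT Nf) {r' : ℝ}
    (hℓG : ∀ bb z, gradK i bb z ≠ 0 → tdist1 Nf (ℓF bb) (ℓS z) ≤ r') (U : CfgY 𝔸 i) (p : FBondY i × κ) (q : SiteY i × κ)
    (h : LinearMap.toMatrix ((Pi.basis fun _ : SiteY i => b).reindex (Equiv.sigmaEquivProd (SiteY i) κ))
      ((Pi.basis fun _ : FBondY i => b).reindex (Equiv.sigmaEquivProd (FBondY i) κ)) (gradY i U) p q ≠ 0) :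
    tdist1 Nf (ℓF p.1) (ℓS q.1) ≤ r' := by
  obtain ⟨bb, k⟩ := p
  obtain ⟨z, l⟩ := q
  refine hℓG bb z fun h0 => h ?_
  rw [toMatrix_gradY_eq, h0, Complex.ofReal_zero, zero_mul]

omit [DecidableEq (SiteY i)] in
/-- `D*_U`: RANGE (`divK(z,b) ≠ 0 ⇒ d₁(ℓS z, ℓF b) ≤ r′`, displayed). [cite: Balaban1985BackgroundPropagators, (3.8) p.392, (3.108) p.416] -/
theorem tdist_le_of_toMatrix_divY_ne_zero (ℓS : SiteY i → UT Nf) (ℓF : FBondY i → UT Nf) {r' : ℝ}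
    (hℓD : ∀ z bb, divK i z bb ≠ 0 → tdist1 Nf (ℓS z) (ℓF bb) ≤ r') (U : CfgY 𝔸 i) (q : SiteY i × κ) (p : FBondY i × κ)
    (h : LinearMap.toMatrix ((Pi.basis fun _ : FBondY i => b).reindex (Equiv.sigmaEquivProd (FBondY i) κ))
      ((Pi.basis fun _ : SiteY i => b).reindex (Equiv.sigmaEquivProd (SiteY i) κ)) (divY i U) q p ≠ 0) :
    tdist1 Nf (ℓS q.1) (ℓF p.1) ≤ r' := by
  obtain ⟨z, k⟩ := q
  obtain ⟨bb, l⟩ := p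
  refine hℓD z bb fun h0 => h ?_
  rw [toMatrix_divY_eq, h0, Complex.ofReal_zero, zero_mul]

variable [NormOneClass 𝔸]

omit [DecidableEq (FBondY i)] in
/-- `D_U` along the pencil: the ENTRY BOUND `≤ |gradK(b,z)|·(cb·(Kη·cl·Kη))` on `‖A′‖ < Rc` (69 with `‖φ_k‖ ≤ cb`, `‖b_l‖ ≤ cl`).
[cite: Balaban1985BackgroundPropagators, (3.3) p.390, Thm 3.4 p.400, (3.108) p.416] -/
theorem norm_toMatrix_gradY_prodCfg_le (hU : ∀ μ x, ‖(U₀ μ x : 𝔸)‖ ≤ K₀) (hUi : ∀ μ x, ‖(((U₀ μ x)⁻¹ : 𝔸ˣ) : 𝔸)‖ ≤ K₀) (hK1 : 1 ≤ K₀)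
    (hRc : 0 ≤ Rc) {cb cl : ℝ} (hcb : ∀ (x : 𝔸) (k : κ), ‖b.repr x k‖ ≤ cb * ‖x‖) (hcb0 : 0 ≤ cb) (hcl : ∀ l, ‖b l‖ ≤ cl)
    {a : Fin (d + 1) → Site (PV d ℓ i.m i.K hd hL) 0 → 𝔸} (ha : a ∈ ball 0 Rc) (p : FBondY i × κ) (q : SiteY i × κ) :
    ‖LinearMap.toMatrix ((Pi.basis fun _ : SiteY i => b).reindex (Equiv.sigmaEquivProd (SiteY i) κ))
      ((Pi.basis fun _ : FBondY i => b).reindex (Equiv.sigmaEquivProd (FBondY i) κ)) (gradY i (prodCfg U₀ η a)) p q‖ ≤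
      |gradK i p.1 q.1| * (cb * (K₀ * Real.exp (|η| * Rc) * cl * (K₀ * Real.exp (|η| * Rc)))) := by
  obtain ⟨bb, k⟩ := p
  obtain ⟨z, l⟩ := q
  set φ : κ → 𝔸 →L[ℂ] ℂ := fun k => (b.coord k).mkContinuous cb (fun x => by rw [Basis.coord_apply]; exact hcb x k) with hφ
  have e1 : LinearMap.toMatrix ((Pi.basis fun _ : SiteY i => b).reindex (Equiv.sigmaEquivProd (SiteY i) κ))
      ((Pi.basis fun _ : FBondY i => b).reindex (Equiv.sigmaEquivProd (FBondY i) κ)) (gradY i (prodCfg U₀ η a)) (bb, k) (z, l) =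
      ((gradK i bb z : ℝ) : ℂ) * φ k (R (gradT i (prodCfg U₀ η a) bb z) (b l)) := by
    rw [toMatrix_gradY_eq, hφ, LinearMap.mkContinuous_apply, Basis.coord_apply]
  rw [e1]
  refine (norm_coord_gradY_prodCfg_le i U₀ η φ b hU hUi hK1 hRc ha bb z k l).trans ?_
  have hK : 0 ≤ K₀ * Real.exp (|η| * Rc) := mul_nonneg (zero_le_one.trans hK1) (Real.exp_nonneg _)
  refine mul_le_mul_of_nonneg_left ?_ (abs_nonneg _)
  refine mul_le_mul (LinearMap.mkContinuous_norm_le _ hcb0 _) ?_ (by positivity) hcb0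
  exact mul_le_mul_of_nonneg_right (mul_le_mul_of_nonneg_left (hcl l) hK) hK

omit [DecidableEq (SiteY i)] in
/-- `D*_U` along the pencil: the ENTRY BOUND `≤ |divK(z,b)|·(cb·(Kη·cl·Kη))` (69). [cite: Balaban1985BackgroundPropagators, (3.8) p.392, Thm 3.4 p.400, (3.108) p.416] -/
theorem norm_toMatrix_divY_prodCfg_le (hU : ∀ μ x, ‖(U₀ μ x : 𝔸)‖ ≤ K₀) (hUi : ∀ μ x, ‖(((U₀ μ x)⁻¹ : 𝔸ˣ) : 𝔸)‖ ≤ K₀) (hK1 : 1 ≤ K₀)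
    (hRc : 0 ≤ Rc) {cb cl : ℝ} (hcb : ∀ (x : 𝔸) (k : κ), ‖b.repr x k‖ ≤ cb * ‖x‖) (hcb0 : 0 ≤ cb) (hcl : ∀ l, ‖b l‖ ≤ cl)
    {a : Fin (d + 1) → Site (PV d ℓ i.m i.K hd hL) 0 → 𝔸} (ha : a ∈ ball 0 Rc) (q : SiteY i × κ) (p : FBondY i × κ) :
    ‖LinearMap.toMatrix ((Pi.basis fun _ : FBondY i => b).reindex (Equiv.sigmaEquivProd (FBondY i) κ))
      ((Pi.basis fun _ : SiteY i => b).reindex (Equiv.sigmaEquivProd (SiteY i) κ)) (divY i (prodCfg U₀ η a)) q p‖ ≤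
      |divK i q.1 p.1| * (cb * (K₀ * Real.exp (|η| * Rc) * cl * (K₀ * Real.exp (|η| * Rc)))) := by
  obtain ⟨z, k⟩ := q
  obtain ⟨bb, l⟩ := p
  set φ : κ → 𝔸 →L[ℂ] ℂ := fun k => (b.coord k).mkContinuous cb (fun x => by rw [Basis.coord_apply]; exact hcb x k) with hφ
  have e1 : LinearMap.toMatrix ((Pi.basis fun _ : FBondY i => b).reindex (Equiv.sigmaEquivProd (FBondY i) κ))
      ((Pi.basis fun _ : SiteY i => b).reindex (Equiv.sigmaEquivProd (SiteY i) κ)) (divY i (prodCfg U₀ η a)) (z, k) (bb, l) =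
      ((divK i z bb : ℝ) : ℂ) * φ k (R (gradT i (prodCfg U₀ η a) bb z)⁻¹ (b l)) := by
    rw [toMatrix_divY_eq, hφ, LinearMap.mkContinuous_apply, Basis.coord_apply]
  rw [e1]
  refine (norm_coord_divY_prodCfg_le i U₀ η φ b hU hUi hK1 hRc ha z bb k l).trans ?_
  have hK : 0 ≤ K₀ * Real.exp (|η| * Rc) := mul_nonneg (zero_le_one.trans hK1) (Real.exp_nonneg _)
  refine mul_le_mul_of_nonneg_left ?_ (abs_nonneg _)
  refine mul_le_mul (LinearMap.mkContinuous_norm_le _ hcb0 _) ?_ (by positivity) hcb0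
  exact mul_le_mul_of_nonneg_right (mul_le_mul_of_nonneg_left (hcl l) hK) hK

omit [DecidableEq (FBondY i)] in
/-- `D_U` along the pencil: ROW SUMS `Σ_{(z,l)} ‖toMatrix(D_U)(b,k)(z,l)‖ ≤ CgR·|κ|·(cb·(Kη·cl·Kη))` from the numeral `CgR ≥ Σ_z |gradK(b,z)|` (print: two endpoints,
`2`). [cite: Balaban1985BackgroundPropagators, (3.3) p.390; Balaban1984PropagatorsII, (2.54) p.232] -/
theorem rowSum_toMatrix_gradY_prodCfg_le (hU : ∀ μ x, ‖(U₀ μ x : 𝔸)‖ ≤ K₀) (hUi : ∀ μ x, ‖(((U₀ μ x)⁻¹ : 𝔸ˣ) : 𝔸)‖ ≤ K₀) (hK1 : 1 ≤ K₀)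
    (hRc : 0 ≤ Rc) {cb cl : ℝ} (hcb : ∀ (x : 𝔸) (k : κ), ‖b.repr x k‖ ≤ cb * ‖x‖) (hcb0 : 0 ≤ cb) (hcl : ∀ l, ‖b l‖ ≤ cl) (hcl0 : 0 ≤ cl)
    {CgR : ℝ} (hCgR : ∀ bb, ∑ z, |gradK i bb z| ≤ CgR)
    {a : Fin (d + 1) → Site (PV d ℓ i.m i.K hd hL) 0 → 𝔸} (ha : a ∈ ball 0 Rc) (p : FBondY i × κ) :
    ∑ q : SiteY i × κ, ‖LinearMap.toMatrix ((Pi.basis fun _ : SiteY i => b).reindex (Equiv.sigmaEquivProd (SiteY i) κ))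
      ((Pi.basis fun _ : FBondY i => b).reindex (Equiv.sigmaEquivProd (FBondY i) κ)) (gradY i (prodCfg U₀ η a)) p q‖ ≤
      CgR * (Fintype.card κ) * (cb * (K₀ * Real.exp (|η| * Rc) * cl * (K₀ * Real.exp (|η| * Rc)))) := by
  set c : ℝ := cb * (K₀ * Real.exp (|η| * Rc) * cl * (K₀ * Real.exp (|η| * Rc))) with hc
  have hK : 0 ≤ K₀ * Real.exp (|η| * Rc) := mul_nonneg (zero_le_one.trans hK1) (Real.exp_nonneg _)
  have hc0 : 0 ≤ c := mul_nonneg hcb0 (mul_nonneg (mul_nonneg hK hcl0) hK)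
  calc ∑ q : SiteY i × κ, ‖LinearMap.toMatrix ((Pi.basis fun _ : SiteY i => b).reindex (Equiv.sigmaEquivProd (SiteY i) κ))
          ((Pi.basis fun _ : FBondY i => b).reindex (Equiv.sigmaEquivProd (FBondY i) κ)) (gradY i (prodCfg U₀ η a)) p q‖
      ≤ ∑ q : SiteY i × κ, |gradK i p.1 q.1| * c :=
        Finset.sum_le_sum fun q _ => norm_toMatrix_gradY_prodCfg_le i b U₀ η hU hUi hK1 hRc hcb hcb0 hcl ha p q
    _ = (∑ z : SiteY i, |gradK i p.1 z|) * (Fintype.card κ) * c := by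
        rw [Fintype.sum_prod_type, Finset.sum_mul, Finset.sum_mul]
        refine Finset.sum_congr rfl fun z _ => ?_
        show ∑ _y : κ, |gradK i p.1 z| * c = _
        rw [Finset.sum_const, Finset.card_univ, nsmul_eq_mul]
        ring
    _ ≤ CgR * (Fintype.card κ) * c :=
        mul_le_mul_of_nonneg_right (mul_le_mul_of_nonneg_right (hCgR p.1) (Nat.cast_nonneg _)) hc0

omit [DecidableEq (SiteY i)] in
/-- `D*_U` along the pencil: COLUMN SUMS `Σ_{(z,l)} ‖toMatrix(D*_U)(z,l)(b,k)‖ ≤ CdC·|κ|·(cb·(Kη·cl·Kη))` from the numeral `CdC ≥ Σ_z |divK(z,b)|` (print: `2`).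
[cite: Balaban1985BackgroundPropagators, (3.8) p.392; Balaban1984PropagatorsII, (2.54) p.232] -/
theorem colSum_toMatrix_divY_prodCfg_le (hU : ∀ μ x, ‖(U₀ μ x : 𝔸)‖ ≤ K₀) (hUi : ∀ μ x, ‖(((U₀ μ x)⁻¹ : 𝔸ˣ) : 𝔸)‖ ≤ K₀) (hK1 : 1 ≤ K₀)
    (hRc : 0 ≤ Rc) {cb cl : ℝ} (hcb : ∀ (x : 𝔸) (k : κ), ‖b.repr x k‖ ≤ cb * ‖x‖) (hcb0 : 0 ≤ cb) (hcl : ∀ l, ‖b l‖ ≤ cl) (hcl0 : 0 ≤ cl)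
    {CdC : ℝ} (hCdC : ∀ bb, ∑ z, |divK i z bb| ≤ CdC)
    {a : Fin (d + 1) → Site (PV d ℓ i.m i.K hd hL) 0 → 𝔸} (ha : a ∈ ball 0 Rc) (p : FBondY i × κ) :
    ∑ q : SiteY i × κ, ‖LinearMap.toMatrix ((Pi.basis fun _ : FBondY i => b).reindex (Equiv.sigmaEquivProd (FBondY i) κ))
      ((Pi.basis fun _ : SiteY i => b).reindex (Equiv.sigmaEquivProd (SiteY i) κ)) (divY i (prodCfg U₀ η a)) q p‖ ≤
      CdC * (Fintype.card κ) * (cb * (K₀ * Real.exp (|η| * Rc) * cl * (K₀ * Real.exp (|η| * Rc)))) := by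
  set c : ℝ := cb * (K₀ * Real.exp (|η| * Rc) * cl * (K₀ * Real.exp (|η| * Rc))) with hc
  have hK : 0 ≤ K₀ * Real.exp (|η| * Rc) := mul_nonneg (zero_le_one.trans hK1) (Real.exp_nonneg _)
  have hc0 : 0 ≤ c := mul_nonneg hcb0 (mul_nonneg (mul_nonneg hK hcl0) hK)
  calc ∑ q : SiteY i × κ, ‖LinearMap.toMatrix ((Pi.basis fun _ : FBondY i => b).reindex (Equiv.sigmaEquivProd (FBondY i) κ))
          ((Pi.basis fun _ : SiteY i => b).reindex (Equiv.sigmaEquivProd (SiteY i) κ)) (divY i (prodCfg U₀ η a)) q p‖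
      ≤ ∑ q : SiteY i × κ, |divK i q.1 p.1| * c :=
        Finset.sum_le_sum fun q _ => norm_toMatrix_divY_prodCfg_le i b U₀ η hU hUi hK1 hRc hcb hcb0 hcl ha q p
    _ = (∑ z : SiteY i, |divK i z p.1|) * (Fintype.card κ) * c := by
        rw [Fintype.sum_prod_type, Finset.sum_mul, Finset.sum_mul]
        refine Finset.sum_congr rfl fun z _ => ?_
        show ∑ _y : κ, |divK i z p.1| * c = _
        rw [Finset.sum_const, Finset.card_univ, nsmul_eq_mul]
        ring
    _ ≤ CdC * (Fintype.card κ) * c :=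
        mul_le_mul_of_nonneg_right (mul_le_mul_of_nonneg_right (hCdC p.1) (Nat.cast_nonneg _)) hc0

end Derivatives

/-! ## §2. The matrix of `Δ_a(U)` = local part + `D_U R(U) D*_U` -/

section Identification

/-- The matrix of `Δ_a(U)` in the bond-sector product basis: `toMatrix(Δ(U) + Q*aQ(U)) + toMatrix(D_U)·toMatrix(R(U))·toMatrix(D*_U)`
(definition `deltaAY = hessY + gradY ∘ RY ∘ divY + QsY ∘ aY ∘ QY`, linearity, `LinearMap.toMatrix_comp`).
[cite: Balaban1985BackgroundPropagators, (3.26) p.395] -/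
theorem toMatrix_deltaAY_eq (parS : SiteParY 𝔸 i) (parB : BondParY 𝔸 i) (Gp : SiteOpY 𝔸 i) (U : CfgY 𝔸 i) :
    LinearMap.toMatrix ((Pi.basis fun _ : FBondY i => b).reindex (Equiv.sigmaEquivProd (FBondY i) κ))
      ((Pi.basis fun _ : FBondY i => b).reindex (Equiv.sigmaEquivProd (FBondY i) κ)) (deltaAY i parS parB Gp U) =
    LinearMap.toMatrix ((Pi.basis fun _ : FBondY i => b).reindex (Equiv.sigmaEquivProd (FBondY i) κ))
        ((Pi.basis fun _ : FBondY i => b).reindex (Equiv.sigmaEquivProd (FBondY i) κ)) (hessY i U + QsY i parB U ∘ₗ aY i ∘ₗ QY i parB U) +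
      LinearMap.toMatrix ((Pi.basis fun _ : SiteY i => b).reindex (Equiv.sigmaEquivProd (SiteY i) κ))
          ((Pi.basis fun _ : FBondY i => b).reindex (Equiv.sigmaEquivProd (FBondY i) κ)) (gradY i U) *
        LinearMap.toMatrix ((Pi.basis fun _ : SiteY i => b).reindex (Equiv.sigmaEquivProd (SiteY i) κ))
          ((Pi.basis fun _ : SiteY i => b).reindex (Equiv.sigmaEquivProd (SiteY i) κ)) (RY i parS Gp U) *
        LinearMap.toMatrix ((Pi.basis fun _ : FBondY i => b).reindex (Equiv.sigmaEquivProd (FBondY i) κ))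
          ((Pi.basis fun _ : SiteY i => b).reindex (Equiv.sigmaEquivProd (SiteY i) κ)) (divY i U) := by
  have hΔ : deltaAY i parS parB Gp U = (hessY i U + QsY i parB U ∘ₗ aY i ∘ₗ QY i parB U) + gradY i U ∘ₗ (RY i parS Gp U ∘ₗ divY i U) := by
    rw [deltaAY, add_right_comm]
  rw [hΔ, map_add, LinearMap.toMatrix_comp _ ((Pi.basis fun _ : SiteY i => b).reindex (Equiv.sigmaEquivProd (SiteY i) κ)),
    LinearMap.toMatrix_comp _ ((Pi.basis fun _ : SiteY i => b).reindex (Equiv.sigmaEquivProd (SiteY i) κ)), Matrix.mul_assoc]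

end Identification

/-! ## §3. ★★ `D_U R(U) D*_U` and `Δ_a(U)` along the pencil -/

section DeltaA

variable [NormOneClass 𝔸]
variable {ν : ℕ} {Nf : Fin ν → ℕ} [∀ j, NeZero (Nf j)]

/-- ★★ **`D_U R(U) D*_U` ALONG THE PENCIL** on the bond sector — (D′)'s sandwich of R's pencil letters `(R, ρ, B_R)` on sites (the R-station's output, displayed)
by the local rectangular `D_U ∕ D*_U` families of §1 (numerals `K₀`, `CgR, CdC ≥ 0`, reading `r′`, basis numerals): NO rate loss,
`RawEntryLetters (A′ ↦ toMatrix(D_U)·toMatrix(R(e^{iηA′}U₀))·toMatrix(D*_U)) (ℓF ∘ fst) R ρ (a_D·b_D·B_R·e^{2ρr′})`.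
[cite: Balaban1985BackgroundPropagators, (3.26) p.395, Thm 3.4 p.400, (3.84)–(3.86) p.407; Balaban1988RG2Cluster, (2.5)–(2.6) p.12; Balaban1984PropagatorsII, (2.54) p.232] -/
theorem rawEntryLetters_toMatrix_DRD_prodCfg (parS : SiteParY 𝔸 i) (Gp : SiteOpY 𝔸 i) {Rd : ℝ}
    (hU : ∀ μ x, ‖(U₀ μ x : 𝔸)‖ ≤ K₀) (hUi : ∀ μ x, ‖(((U₀ μ x)⁻¹ : 𝔸ˣ) : 𝔸)‖ ≤ K₀) (hK1 : 1 ≤ K₀) (hR0 : 0 ≤ Rd)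
    {CgR CdC : ℝ} (hCgR0 : 0 ≤ CgR) (hCgR : ∀ bb, ∑ z, |gradK i bb z| ≤ CgR) (hCdC0 : 0 ≤ CdC) (hCdC : ∀ bb, ∑ z, |divK i z bb| ≤ CdC)
    {cb cl : ℝ} (hcb : ∀ (x : 𝔸) (k : κ), ‖b.repr x k‖ ≤ cb * ‖x‖) (hcb0 : 0 ≤ cb) (hcl : ∀ l, ‖b l‖ ≤ cl) (hcl0 : 0 ≤ cl)
    (ℓS : SiteY i → UT Nf) (ℓF : FBondY i → UT Nf) {r' : ℝ}
    (hℓG : ∀ bb z, gradK i bb z ≠ 0 → tdist1 Nf (ℓF bb) (ℓS z) ≤ r') (hℓD : ∀ z bb, divK i z bb ≠ 0 → tdist1 Nf (ℓS z) (ℓF bb) ≤ r')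
    {ρ BR : ℝ} (hρ : 0 ≤ ρ)
    (hR : RawEntryLetters (fun a : Fin (d + 1) → Site (PV d ℓ i.m i.K hd hL) 0 → 𝔸 =>
      LinearMap.toMatrix ((Pi.basis fun _ : SiteY i => b).reindex (Equiv.sigmaEquivProd (SiteY i) κ))
        ((Pi.basis fun _ : SiteY i => b).reindex (Equiv.sigmaEquivProd (SiteY i) κ)) (RY i parS Gp (prodCfg U₀ η a)))
      (fun q : SiteY i × κ => ℓS q.1) Rd ρ BR) :
    RawEntryLetters (fun a : Fin (d + 1) → Site (PV d ℓ i.m i.K hd hL) 0 → 𝔸 =>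
        LinearMap.toMatrix ((Pi.basis fun _ : SiteY i => b).reindex (Equiv.sigmaEquivProd (SiteY i) κ))
            ((Pi.basis fun _ : FBondY i => b).reindex (Equiv.sigmaEquivProd (FBondY i) κ)) (gradY i (prodCfg U₀ η a)) *
          LinearMap.toMatrix ((Pi.basis fun _ : SiteY i => b).reindex (Equiv.sigmaEquivProd (SiteY i) κ))
            ((Pi.basis fun _ : SiteY i => b).reindex (Equiv.sigmaEquivProd (SiteY i) κ)) (RY i parS Gp (prodCfg U₀ η a)) *
          LinearMap.toMatrix ((Pi.basis fun _ : FBondY i => b).reindex (Equiv.sigmaEquivProd (FBondY i) κ))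
            ((Pi.basis fun _ : SiteY i => b).reindex (Equiv.sigmaEquivProd (SiteY i) κ)) (divY i (prodCfg U₀ η a)))
      (fun p : FBondY i × κ => ℓF p.1) Rd ρ
      (CgR * (Fintype.card κ) * (cb * (K₀ * Real.exp (|η| * Rd) * cl * (K₀ * Real.exp (|η| * Rd)))) *
        (CdC * (Fintype.card κ) * (cb * (K₀ * Real.exp (|η| * Rd) * cl * (K₀ * Real.exp (|η| * Rd))))) * BR * Real.exp (2 * ρ * r')) := by
  have hK : 0 ≤ K₀ * Real.exp (|η| * Rd) := mul_nonneg (zero_le_one.trans hK1) (Real.exp_nonneg _)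
  have hc0 : 0 ≤ cb * (K₀ * Real.exp (|η| * Rd) * cl * (K₀ * Real.exp (|η| * Rd))) := mul_nonneg hcb0 (mul_nonneg (mul_nonneg hK hcl0) hK)
  have ha0 : 0 ≤ CgR * (Fintype.card κ) * (cb * (K₀ * Real.exp (|η| * Rd) * cl * (K₀ * Real.exp (|η| * Rd)))) :=
    mul_nonneg (mul_nonneg hCgR0 (Nat.cast_nonneg _)) hc0
  have hb0 : 0 ≤ CdC * (Fintype.card κ) * (cb * (K₀ * Real.exp (|η| * Rd) * cl * (K₀ * Real.exp (|η| * Rd)))) :=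
    mul_nonneg (mul_nonneg hCdC0 (Nat.cast_nonneg _)) hc0
  exact rawEntryLetters_sandwich_family (locp := fun p : FBondY i × κ => ℓF p.1) hR hρ
    (A := fun a => LinearMap.toMatrix ((Pi.basis fun _ : SiteY i => b).reindex (Equiv.sigmaEquivProd (SiteY i) κ))
        ((Pi.basis fun _ : FBondY i => b).reindex (Equiv.sigmaEquivProd (FBondY i) κ)) (gradY i (prodCfg U₀ η a)))
    (B' := fun a => LinearMap.toMatrix ((Pi.basis fun _ : FBondY i => b).reindex (Equiv.sigmaEquivProd (FBondY i) κ))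
        ((Pi.basis fun _ : SiteY i => b).reindex (Equiv.sigmaEquivProd (SiteY i) κ)) (divY i (prodCfg U₀ η a)))
    (r := r') ha0 hb0
    (fun p q => differentiableOn_toMatrix_gradY_prodCfg i b U₀ η hcb p q)
    (fun a _ p q hne => tdist_le_of_toMatrix_gradY_ne_zero i b ℓS ℓF hℓG (prodCfg U₀ η a) p q hne)
    (fun a ha p => rowSum_toMatrix_gradY_prodCfg_le i b U₀ η hU hUi hK1 hR0 hcb hcb0 hcl hcl0 hCgR ha p)
    (fun q p => differentiableOn_toMatrix_divY_prodCfg i b U₀ η hcb q p)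
    (fun a _ q p hne => tdist_le_of_toMatrix_divY_ne_zero i b ℓS ℓF hℓD (prodCfg U₀ η a) q p hne)
    (fun a ha p => colSum_toMatrix_divY_prodCfg_le i b U₀ η hU hUi hK1 hR0 hcb hcb0 hcl hcl0 hCdC ha p)

/-- ★★ **`Δ_a(e^{iηA′}U₀)` ALONG THE PENCIL IN N10 COORDINATES** (any `parS`, `parB`, `Gp`): the local part's pencil letters `hLoc` (`Δ(U) + Q*aQ(U)` on the bond sector — the lane's 71 ∕ 73 ∕
`B13OpsYPencilDeltaALocal` facts packaged; DISPLAYED) plus §3's `D_U R D*_U` (34 `rawEntryLetters_add`, identification `toMatrix_deltaAY_eq`):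
`RawEntryLetters (A′ ↦ toMatrix (Δ_a(e^{iηA′}U₀))) (ℓF ∘ fst) R ρ (B_L + a_D·b_D·B_R·e^{2ρr′})`.
[cite: Balaban1985BackgroundPropagators, (3.26) p.395, Thm 3.4 p.400, (3.84) p.407; Balaban1988RG2Cluster, (2.5)–(2.7) pp.12–13] -/
theorem rawEntryLetters_toMatrix_deltaAY_prodCfg (parS : SiteParY 𝔸 i) (parB : BondParY 𝔸 i) (Gp : SiteOpY 𝔸 i) {Rd : ℝ}
    (hU : ∀ μ x, ‖(U₀ μ x : 𝔸)‖ ≤ K₀) (hUi : ∀ μ x, ‖(((U₀ μ x)⁻¹ : 𝔸ˣ) : 𝔸)‖ ≤ K₀) (hK1 : 1 ≤ K₀) (hR0 : 0 ≤ Rd)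
    {CgR CdC : ℝ} (hCgR0 : 0 ≤ CgR) (hCgR : ∀ bb, ∑ z, |gradK i bb z| ≤ CgR) (hCdC0 : 0 ≤ CdC) (hCdC : ∀ bb, ∑ z, |divK i z bb| ≤ CdC)
    {cb cl : ℝ} (hcb : ∀ (x : 𝔸) (k : κ), ‖b.repr x k‖ ≤ cb * ‖x‖) (hcb0 : 0 ≤ cb) (hcl : ∀ l, ‖b l‖ ≤ cl) (hcl0 : 0 ≤ cl)
    (ℓS : SiteY i → UT Nf) (ℓF : FBondY i → UT Nf) {r' : ℝ}
    (hℓG : ∀ bb z, gradK i bb z ≠ 0 → tdist1 Nf (ℓF bb) (ℓS z) ≤ r') (hℓD : ∀ z bb, divK i z bb ≠ 0 → tdist1 Nf (ℓS z) (ℓF bb) ≤ r')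
    {ρ BR BL : ℝ} (hρ : 0 ≤ ρ)
    (hR : RawEntryLetters (fun a : Fin (d + 1) → Site (PV d ℓ i.m i.K hd hL) 0 → 𝔸 =>
      LinearMap.toMatrix ((Pi.basis fun _ : SiteY i => b).reindex (Equiv.sigmaEquivProd (SiteY i) κ))
        ((Pi.basis fun _ : SiteY i => b).reindex (Equiv.sigmaEquivProd (SiteY i) κ)) (RY i parS Gp (prodCfg U₀ η a)))
      (fun q : SiteY i × κ => ℓS q.1) Rd ρ BR)
    (hLoc : RawEntryLetters (fun a : Fin (d + 1) → Site (PV d ℓ i.m i.K hd hL) 0 → 𝔸 =>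
      LinearMap.toMatrix ((Pi.basis fun _ : FBondY i => b).reindex (Equiv.sigmaEquivProd (FBondY i) κ))
        ((Pi.basis fun _ : FBondY i => b).reindex (Equiv.sigmaEquivProd (FBondY i) κ))
        (hessY i (prodCfg U₀ η a) + QsY i parB (prodCfg U₀ η a) ∘ₗ aY i ∘ₗ QY i parB (prodCfg U₀ η a)))
      (fun p : FBondY i × κ => ℓF p.1) Rd ρ BL) :
    RawEntryLetters (fun a : Fin (d + 1) → Site (PV d ℓ i.m i.K hd hL) 0 → 𝔸 =>
        LinearMap.toMatrix ((Pi.basis fun _ : FBondY i => b).reindex (Equiv.sigmaEquivProd (FBondY i) κ))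
          ((Pi.basis fun _ : FBondY i => b).reindex (Equiv.sigmaEquivProd (FBondY i) κ))
          (deltaAY i parS parB Gp (prodCfg U₀ η a)))
      (fun p : FBondY i × κ => ℓF p.1) Rd ρ
      (BL + CgR * (Fintype.card κ) * (cb * (K₀ * Real.exp (|η| * Rd) * cl * (K₀ * Real.exp (|η| * Rd)))) *
        (CdC * (Fintype.card κ) * (cb * (K₀ * Real.exp (|η| * Rd) * cl * (K₀ * Real.exp (|η| * Rd))))) * BR * Real.exp (2 * ρ * r')) := by
  have hDRD := rawEntryLetters_toMatrix_DRD_prodCfg i b U₀ η parS Gp hU hUi hK1 hR0 hCgR0 hCgR hCdC0 hCdC hcb hcb0 hcl hcl0 ℓS ℓF hℓG hℓD hρ hR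
  refine rawEntryLetters_congr (rawEntryLetters_add hLoc hDRD) fun a _ => ?_
  rw [toMatrix_deltaAY_eq]

end DeltaA

/-! ## §4. ★★★ THE G-JUNCTION: `G(e^{iηA′}U₀) = Δ_a(e^{iηA′}U₀)⁻¹` in N10 coordinates -/

section Green

variable [NormOneClass 𝔸]
variable {ν : ℕ} {Nf : Fin ν → ℕ} [∀ j, NeZero (Nf j)]

/-- ★★★ **THE G-JUNCTION — THE END OF PRINT's CHAIN AT NODE 00's OBJECTS.**  Along pv27's pencil, the matrices of NODE 00's propagator
`G = Δ_a⁻¹` (`Node00.GAY i parS parB Gp`) in the bond-sector product basis have the N10 letters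
`RawEntryLetters (A′ ↦ toMatrix (G(e^{iηA′}U₀))) (ℓF ∘ fst) R₁⋆ ρ′ (2·cb·cl·B_Γ)` at the located thin radius (p595959 ∕ p601656 §5), for every `0 ≤ ρ′ < ρ`.
DISPLAYED: the local part's pencil letters `hLoc` (the lane's), R's pencil letters `hR` (the R-station's output — hence G′'s and X⁻¹'s junctions, i.e. N06's
Thm 3.1 ∕ 3.2 at `U₀`), the `D ∕ D*` numerals and readings, the basis numerals, a fibre bound of `ℓF`, `0 < R`, and N06's content for `G` at the ONE real
background: `IsUnit (Δ_a(U₀))` and the pointwise (3.108)-type bound `‖G(U₀)(δ_b ⊗ E)(b′)‖ ≤ B_Γ‖E‖e^{−ρ d(ℓF b′, ℓF b)}` (Thm 3.3 ∕ 3.10).  No `R₁`, no smallness,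
no complexification hypothesis — Sect. B's (3.84)–(3.86) for `G` at NODE 00's letters.
[cite: Balaban1985BackgroundPropagators, (3.26)–(3.27) p.395, Thm 3.3 p.399, Thm 3.4 p.400, (3.84)–(3.86) p.407, Thm 3.10 (3.107)–(3.108) p.416;
Balaban1988RG2Cluster, (2.5)–(2.7) pp.12–13, p.15; Balaban1984PropagatorsII, Lemma 2.1 (2.61) p.234] -/
theorem rawEntryLetters_toMatrix_GAY_prodCfg_of_pencil (parS : SiteParY 𝔸 i) (parB : BondParY 𝔸 i) (Gp : SiteOpY 𝔸 i) {Rd : ℝ}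
    (hU : ∀ μ x, ‖(U₀ μ x : 𝔸)‖ ≤ K₀) (hUi : ∀ μ x, ‖(((U₀ μ x)⁻¹ : 𝔸ˣ) : 𝔸)‖ ≤ K₀) (hK1 : 1 ≤ K₀) (hRpos : 0 < Rd)
    {CgR CdC : ℝ} (hCgR0 : 0 ≤ CgR) (hCgR : ∀ bb, ∑ z, |gradK i bb z| ≤ CgR) (hCdC0 : 0 ≤ CdC) (hCdC : ∀ bb, ∑ z, |divK i z bb| ≤ CdC)
    {cb cl : ℝ} (hcb : ∀ (x : 𝔸) (k : κ), ‖b.repr x k‖ ≤ cb * ‖x‖) (hcb0 : 0 ≤ cb) (hcl : ∀ l, ‖b l‖ ≤ cl) (hcl0 : 0 ≤ cl)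
    (ℓS : SiteY i → UT Nf) (ℓF : FBondY i → UT Nf) {r' : ℝ}
    (hℓG : ∀ bb z, gradK i bb z ≠ 0 → tdist1 Nf (ℓF bb) (ℓS z) ≤ r') (hℓD : ∀ z bb, divK i z bb ≠ 0 → tdist1 Nf (ℓS z) (ℓF bb) ≤ r')
    {mF : ℕ} (hfibF : ∀ y : UT Nf, (univ.filter fun p : FBondY i × κ => ℓF p.1 = y).card ≤ mF)
    {ρ BR BL : ℝ} (hρ : 0 ≤ ρ)
    (hR : RawEntryLetters (fun a : Fin (d + 1) → Site (PV d ℓ i.m i.K hd hL) 0 → 𝔸 =>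
      LinearMap.toMatrix ((Pi.basis fun _ : SiteY i => b).reindex (Equiv.sigmaEquivProd (SiteY i) κ))
        ((Pi.basis fun _ : SiteY i => b).reindex (Equiv.sigmaEquivProd (SiteY i) κ)) (RY i parS Gp (prodCfg U₀ η a)))
      (fun q : SiteY i × κ => ℓS q.1) Rd ρ BR)
    (hLoc : RawEntryLetters (fun a : Fin (d + 1) → Site (PV d ℓ i.m i.K hd hL) 0 → 𝔸 =>
      LinearMap.toMatrix ((Pi.basis fun _ : FBondY i => b).reindex (Equiv.sigmaEquivProd (FBondY i) κ))
        ((Pi.basis fun _ : FBondY i => b).reindex (Equiv.sigmaEquivProd (FBondY i) κ))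
        (hessY i (prodCfg U₀ η a) + QsY i parB (prodCfg U₀ η a) ∘ₗ aY i ∘ₗ QY i parB (prodCfg U₀ η a)))
      (fun p : FBondY i × κ => ℓF p.1) Rd ρ BL)
    -- N06's content at the ONE real background `U₀` for `G = Δ_a⁻¹`: invertibility (Thm 3.3) and Theorem 3.10's kernel bound
    (hunit : IsUnit (deltaAY i parS parB Gp U₀)) {BΓ : ℝ} (hBΓ : 0 ≤ BΓ)
    (hO : ∀ x y (E : 𝔸), ‖GAY i parS parB Gp U₀ (Pi.single x E) y‖ ≤
      BΓ * ‖E‖ * Real.exp (-(ρ * tdist1 Nf (ℓF y) (ℓF x))))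
    {ρ' : ℝ} (hρ'0 : 0 ≤ ρ') (hρ' : ρ' < ρ) :
    RawEntryLetters (fun a : Fin (d + 1) → Site (PV d ℓ i.m i.K hd hL) 0 → 𝔸 =>
        LinearMap.toMatrix ((Pi.basis fun _ : FBondY i => b).reindex (Equiv.sigmaEquivProd (FBondY i) κ))
          ((Pi.basis fun _ : FBondY i => b).reindex (Equiv.sigmaEquivProd (FBondY i) κ))
          (GAY i parS parB Gp (prodCfg U₀ η a)))
      (fun p : FBondY i × κ => ℓF p.1)
      (Rd / (4 * ((BL + CgR * (Fintype.card κ) * (cb * (K₀ * Real.exp (|η| * Rd) * cl * (K₀ * Real.exp (|η| * Rd)))) *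
          (CdC * (Fintype.card κ) * (cb * (K₀ * Real.exp (|η| * Rd) * cl * (K₀ * Real.exp (|η| * Rd))))) * BR * Real.exp (2 * ρ * r')) *
          (cb * cl * BΓ) * (mF * B6.c0 1 ((ρ - ρ') / 3) ^ ν) * (mF * B6.c0 1 ((ρ - ρ') / 3) ^ ν)) + 1))
      ρ' (2 * (cb * cl * BΓ)) := by
  have hA := rawEntryLetters_toMatrix_deltaAY_prodCfg i b U₀ η parS parB Gp hU hUi hK1 hRpos.le hCgR0 hCgR hCdC0 hCdC hcb hcb0 hcl hcl0 ℓS ℓF hℓG hℓD hρ hR hLoc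
  have h0 : deltaAY i parS parB Gp (prodCfg U₀ η 0) * GAY i parS parB Gp U₀ = 1 := by
    rw [prodCfg_zero]
    exact deltaAY_mul_GAY i hunit
  exact rawEntryLetters_toMatrix_ringInverse_located_of_kernelBound b (fun a => deltaAY i parS parB Gp (prodCfg U₀ η a))
    ℓF hA h0 hcb hcb0 hcl hcl0 hBΓ hO hfibF hRpos hρ'0 hρ'

end Green

end Literature.MathematicalPhysics.QuantumFieldTheory.Balaban1983to89.B13OpsYPencilGreen

end
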